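import Literature.NumberTheory.Sieve.RosserSieveLemma13Asymptotics
import HarnessLib

/-!
# Iwaniec's Lemma 13: discharge of the named fact `RosserMajorant.Iwaniec1980_lemma13`

Topic `Literature/NumberTheory/Sieve`; Iwaniec, *Rosser's sieve*, Acta Arith. 36 (1980), §6, Lemma 13
(p. 189): for `κ > 1/2` and `β − 1` the largest root of `g`, the continuous solution `Q^±` of
(6.1)–(6.2) is positive and satisfies, for `s ≥ 2`, (6.3) `Q⁺ ≪ Q⁻ ≪ Q⁺`, (6.4)
`Q⁺(s) s log s ≪ Q⁺(s − 1) ≪ s² Q⁺(s)`, (6.5)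
`Q⁺(s) = exp{−s log s − s log log s + s log eκ + O(s log log 2s/log s)}`. The named fact
`RosserMajorant.Iwaniec1980_lemma13` (`RosserSieveMajorants.lean`) vendors this over the greatest
`β`-sieve data of dimension `κ > 1/2`; this file PROVES it (`Iwaniec1980_lemma13_holds`), assembling

* `β > 1` and positivity (`RosserSieveLemma14.lean`: `one_lt_beta`, `qUpper_pos_qLower_pos`);
* (6.3) and the two halves of (6.4) for large `s` (`RosserSieveLemma13Ratios.lean`:
  `exists_QLower_le_QUpper`, `majA_sub_one_le`, `exists_majA_sub_one_ge`);
* (6.5) for large `s` from the two barriers for `a = Q⁺ + Q⁻` (`RosserSieveLemma13Asymptotics.lean`: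
  `exists_majA_lt_exp`, `exists_exp_lt_majA`) and `Q⁺ ≤ a ≤ (1 + c₂) Q⁺`;
* the bounded ranges `2 ≤ s ≤ S` by continuity and positivity on compact intervals
  (`exists_ratio_le`).

Iwaniec's own route to (6.4)–(6.5) is through his Lemmas 15–16; the held copy of the paper has no
text layer, so the proofs of the large-`s` statements are the formaliser's (Greaves, §4.3.2, for
(6.3) and the right half of (6.4)); the statement discharged is exactly the vendored one.

## References

* H. Iwaniec, *Rosser's sieve*, Acta Arith. 36 (1980), 171–202: §6, (6.1)–(6.5), Lemma 13 (p. 189),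
  Lemmas 14–16; p. 173. [IwaniecActaArith1980]
* G. Greaves, *Sieves in Number Theory*, Springer (2001), §4.3.2, Lemma 4.3.3. [Greaves2001]
-/

open Filter Set MeasureTheory intervalIntegral
open scoped Topology

noncomputable section

namespace Literature.NumberTheory.Sieve

open SieveAdjoint RosserMajorant BetaSieve

namespace RosserMajorant

variable {κ β : ℝ}

/-! ### Compact ranges -/

/-- **Ratio bound on a compact interval**: if `f, g` are continuous on `[a, b]` and `g > 0` there,
then `f ≤ K g` on `[a, b]` for some `K > 0`. [folklore] -/
theorem exists_ratio_le {f g : ℝ → ℝ} {a b : ℝ} (hf : ContinuousOn f (Icc a b))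
    (hg : ContinuousOn g (Icc a b)) (hpos : ∀ x ∈ Icc a b, 0 < g x) :
    ∃ K : ℝ, 0 < K ∧ ∀ x ∈ Icc a b, f x ≤ K * g x := by
  rcases le_or_gt a b with hab | hab
  · obtain ⟨C, hC⟩ := isCompact_Icc.exists_bound_of_continuousOn hf
    obtain ⟨x₀, hx₀, hmin⟩ := isCompact_Icc.exists_isMinOn (nonempty_Icc.mpr hab) hg
    have hμ : 0 < g x₀ := hpos x₀ hx₀
    have hC0 : 0 ≤ C := (norm_nonneg _).trans (hC a (left_mem_Icc.mpr hab))
    refine ⟨max 1 (C / g x₀), lt_of_lt_of_le one_pos (le_max_left _ _), fun x hx => ?_⟩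
    have h1 : f x ≤ C := (le_abs_self _).trans (by simpa only [Real.norm_eq_abs] using hC x hx)
    have h2 : g x₀ ≤ g x := hmin hx
    calc f x ≤ C := h1
      _ = (C / g x₀) * g x₀ := by field_simp
      _ ≤ (C / g x₀) * g x := mul_le_mul_of_nonneg_left h2 (div_nonneg hC0 hμ.le)
      _ ≤ max 1 (C / g x₀) * g x := mul_le_mul_of_nonneg_right (le_max_right _ _) (hpos x hx).le
  · refine ⟨1, one_pos, fun x hx => ?_⟩
    exact absurd (hx.1.trans hx.2) (not_le.mpr hab)

/-! ### `Q⁺`: continuity and positivity -/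

/-- `Q⁺` is continuous on `(0, ∞)` (`β > 1`). [folklore] -/
theorem continuousOn_QUpper (hβ : 1 < β) : ContinuousOn (QUpper κ β) (Ioi 0) := by
  have h : ContinuousOn (fun s : ℝ => s ^ (-(κ + 1)) * qUpper κ β s) (Ioi 0) :=
    (continuousOn_id.rpow_const fun _ ht => Or.inl (ne_of_gt ht)).mul (continuousOn_qUpper hβ)
  exact h.congr fun s _ => QUpper_def κ β s

/-- `log log(2s) > 0` for `s ≥ 2` (`log 4 > 1`). [folklore] -/
theorem log_log_two_mul_pos {s : ℝ} (hs : 2 ≤ s) : 0 < Real.log (Real.log (2 * s)) := by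
  refine Real.log_pos ?_
  have h4 : Real.exp 1 < 2 * s := by
    have := Real.exp_one_lt_d9; linarith
  have := Real.log_lt_log (Real.exp_pos 1) h4
  rwa [Real.log_exp] at this

section Main

variable (hκ : 0 < κ) (hβ : 1 < β) (h0 : qFun κ (β - 1) = 0)
  (hg : ∀ x : ℝ, β - 1 < x → 0 < qFun κ x)
include hκ hβ h0 hg

/-- `Q⁺ > 0` on `(0, ∞)`. [cite: IwaniecActaArith1980, Lemma 13] -/
theorem QUpper_pos {s : ℝ} (hs : 0 < s) : 0 < QUpper κ β s := by
  rw [QUpper_def]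
  exact mul_pos (Real.rpow_pos_of_pos hs _) (qUpper_pos_qLower_pos hκ hβ h0 hg s).1

/-! ### The three estimates for all `s ≥ 2` -/

/-- **(6.4), right half, for all `s ≥ 2`**: `Q⁺(s − 1) ≤ c (s² Q⁺(s))`.
[cite: IwaniecActaArith1980, Lemma 13 (6.4)] -/
theorem exists_QUpper_sub_one_le :
    ∃ c : ℝ, 0 < c ∧ ∀ s : ℝ, 2 ≤ s → QUpper κ β (s - 1) ≤ c * (s ^ 2 * QUpper κ β s) := by
  obtain ⟨c₁, c₂, hc₁, hc₂, hQ⟩ := exists_QLower_le_QUpper hκ hβ h0 hg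
  -- the compact range `[2, β + 5/2]`
  have hcf : ContinuousOn (fun s => QUpper κ β (s - 1)) (Icc 2 (β + 5 / 2)) :=
    (continuousOn_QUpper hβ).comp (continuousOn_id.sub continuousOn_const)
      fun s hs => show (0:ℝ) < id s - 1 by simp only [id]; linarith [hs.1]
  have hcg : ContinuousOn (fun s => s ^ 2 * QUpper κ β s) (Icc 2 (β + 5 / 2)) :=
    (continuousOn_id.pow 2).mul ((continuousOn_QUpper hβ).mono fun s hs =>
      show (0:ℝ) < s by linarith [hs.1])
  obtain ⟨K, hK, hKb⟩ := exists_ratio_le hcf hcg fun s hs =>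
    mul_pos (pow_pos (show (0:ℝ) < s by linarith [hs.1]) 2)
      (QUpper_pos hκ hβ h0 hg (show (0:ℝ) < s by linarith [hs.1]))
  refine ⟨max K (4 * (1 + c₂) / κ ^ 2), lt_of_lt_of_le hK (le_max_left _ _), fun s hs => ?_⟩
  have hs0 : 0 < s := by linarith
  have hQs := QUpper_pos hκ hβ h0 hg hs0
  have hsq : 0 ≤ s ^ 2 * QUpper κ β s := by positivity
  rcases le_or_gt s (β + 5 / 2) with h | h
  · exact (hKb s ⟨hs, h⟩).trans (mul_le_mul_of_nonneg_right (le_max_left _ _) hsq)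
  · obtain ⟨-, -, hUa, -⟩ := hQ (s - 1) (by linarith)
    obtain ⟨-, -, -, haU⟩ := hQ s hs0
    have h1 := majA_sub_one_le hκ hβ h0 hg h.le
    calc QUpper κ β (s - 1) ≤ majA κ β (s - 1) := hUa
      _ ≤ 4 * s ^ 2 / κ ^ 2 * majA κ β s := h1
      _ ≤ 4 * s ^ 2 / κ ^ 2 * ((1 + c₂) * QUpper κ β s) :=
          mul_le_mul_of_nonneg_left haU (by positivity)
      _ = 4 * (1 + c₂) / κ ^ 2 * (s ^ 2 * QUpper κ β s) := by ring
      _ ≤ max K (4 * (1 + c₂) / κ ^ 2) * (s ^ 2 * QUpper κ β s) :=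
          mul_le_mul_of_nonneg_right (le_max_right _ _) hsq

/-- **(6.4), left half, for all `s ≥ 2`**: `c (Q⁺(s) s log s) ≤ Q⁺(s − 1)`.
[cite: IwaniecActaArith1980, Lemma 13 (6.4)] -/
theorem exists_QUpper_sub_one_ge :
    ∃ c : ℝ, 0 < c ∧ ∀ s : ℝ, 2 ≤ s → c * (QUpper κ β s * (s * Real.log s)) ≤ QUpper κ β (s - 1) := by
  obtain ⟨c₁, c₂, hc₁, hc₂, hQ⟩ := exists_QLower_le_QUpper hκ hβ h0 hg
  obtain ⟨L, hL, hstep⟩ := exists_majA_sub_one_ge hκ hβ h0 hg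
  set S : ℝ := max 2 (Real.exp (2 * L)) with hSdef
  -- the compact range `[2, S]`
  have hcf : ContinuousOn (fun s => QUpper κ β s * (s * Real.log s)) (Icc 2 S) :=
    ((continuousOn_QUpper hβ).mono fun s hs => show (0:ℝ) < s by linarith [hs.1]).mul
      (continuousOn_id.mul (Real.continuousOn_log.mono fun s hs =>
        show s ≠ 0 from ne_of_gt (by linarith [hs.1])))
  have hcg : ContinuousOn (fun s => QUpper κ β (s - 1)) (Icc 2 S) :=
    (continuousOn_QUpper hβ).comp (continuousOn_id.sub continuousOn_const)
      fun s hs => show (0:ℝ) < id s - 1 by simp only [id]; linarith [hs.1]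
  obtain ⟨K, hK, hKb⟩ := exists_ratio_le hcf hcg fun s hs =>
    QUpper_pos hκ hβ h0 hg (show (0:ℝ) < s - 1 by linarith [hs.1])
  set c : ℝ := min (1 / K) (1 / (2 * κ * (1 + c₂))) with hcdef
  have hc0 : 0 < c := lt_min (by positivity) (by positivity)
  refine ⟨c, hc0, fun s hs => ?_⟩
  have hs0 : 0 < s := by linarith
  have hQs := QUpper_pos hκ hβ h0 hg hs0
  have hlog0 : 0 ≤ Real.log s := Real.log_nonneg (by linarith)
  have hprod : 0 ≤ QUpper κ β s * (s * Real.log s) := by positivity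
  rcases le_or_gt s S with h | h
  · have h1 := hKb s ⟨hs, h⟩
    calc c * (QUpper κ β s * (s * Real.log s)) ≤ (1 / K) * (QUpper κ β s * (s * Real.log s)) :=
          mul_le_mul_of_nonneg_right (min_le_left _ _) hprod
      _ ≤ (1 / K) * (K * QUpper κ β (s - 1)) := mul_le_mul_of_nonneg_left h1 (by positivity)
      _ = QUpper κ β (s - 1) := by field_simp
  · -- `log s ≥ 2L`, so `s (log s / 2) a(s) ≤ s (log s - L) a(s) < κ a(s - 1)`
    have hlogs : 2 * L ≤ Real.log s := by
      have h2 : Real.exp (2 * L) < s := lt_of_le_of_lt (le_max_right _ _) h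
      have := Real.log_le_log (Real.exp_pos _) h2.le
      rwa [Real.log_exp] at this
    have hst := hstep s (by linarith)
    have has : 0 < majA κ β s := majA_pos hκ hβ h0 hg hs0
    obtain ⟨-, -, hUa, -⟩ := hQ s hs0
    obtain ⟨-, -, -, haU⟩ := hQ (s - 1) (by linarith)
    have h1 : s * (Real.log s / 2) * majA κ β s ≤ s * (Real.log s - L) * majA κ β s := by
      have : Real.log s / 2 ≤ Real.log s - L := by linarith
      exact mul_le_mul_of_nonneg_right (mul_le_mul_of_nonneg_left this hs0.le) has.le
    have h2 : s * Real.log s * QUpper κ β s ≤ 2 * κ * ((1 + c₂) * QUpper κ β (s - 1)) := by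
      have h3 := mul_le_mul_of_nonneg_left hUa (show 0 ≤ s * Real.log s by positivity)
      have h4 := mul_le_mul_of_nonneg_left haU hκ.le
      nlinarith [h1, hst, h3, h4]
    calc c * (QUpper κ β s * (s * Real.log s))
        ≤ (1 / (2 * κ * (1 + c₂))) * (QUpper κ β s * (s * Real.log s)) :=
          mul_le_mul_of_nonneg_right (min_le_right _ _) hprod
      _ = (s * Real.log s * QUpper κ β s) / (2 * κ * (1 + c₂)) := by ring
      _ ≤ (2 * κ * ((1 + c₂) * QUpper κ β (s - 1))) / (2 * κ * (1 + c₂)) :=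
          div_le_div_of_nonneg_right h2 (by positivity)
      _ = QUpper κ β (s - 1) := by field_simp

/-- **(6.5) for all `s ≥ 2`**:
`|log Q⁺(s) − (−s log s − s log log s + s log(eκ))| ≤ C s log log(2s)/log s`.
[cite: IwaniecActaArith1980, Lemma 13 (6.5)] -/
theorem exists_abs_log_QUpper_le :
    ∃ C : ℝ, ∀ s : ℝ, 2 ≤ s →
      |Real.log (QUpper κ β s) -
          (-s * Real.log s - s * Real.log (Real.log s) + s * Real.log (Real.exp 1 * κ))| ≤
        C * (s * Real.log (Real.log (2 * s)) / Real.log s) := by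
  obtain ⟨c₁, c₂, hc₁, hc₂, hQ⟩ := exists_QLower_le_QUpper hκ hβ h0 hg
  obtain ⟨M, TU, hM, hTU, hup⟩ := exists_majA_lt_exp hκ hβ h0 hg
  obtain ⟨m, TL, hm, hTL, hlow⟩ := exists_exp_lt_majA hκ hβ h0 hg
  set T : ℝ := max (max TU TL) (Real.exp (Real.exp 1)) with hTdef
  have hT_U : TU ≤ T := (le_max_left _ _).trans (le_max_left _ _)
  have hT_L : TL ≤ T := (le_max_right _ _).trans (le_max_left _ _)
  have hT_e : Real.exp (Real.exp 1) ≤ T := le_max_right _ _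
  have hT2 : 2 < T := lt_of_lt_of_le hTU hT_U
  -- the main-term exponent
  set Φ : ℝ → ℝ := fun x => x * Real.log x + x * Real.log (Real.log x) -
    x * Real.log (Real.exp 1 * κ) with hΦdef
  have hmain : ∀ s : ℝ, Real.log (QUpper κ β s) -
      (-s * Real.log s - s * Real.log (Real.log s) + s * Real.log (Real.exp 1 * κ)) =
        Real.log (QUpper κ β s) + Φ s := fun s => by simp only [hΦdef]; ring
  -- the compact range `[2, T]`
  have hcf : ContinuousOn (fun s => |Real.log (QUpper κ β s) + Φ s|) (Icc 2 T) := by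
    refine ContinuousOn.abs (ContinuousOn.add ?_ ((continuousOn_phi hκ).mono fun s hs =>
      show (1:ℝ) < s by linarith [hs.1]))
    exact ((continuousOn_QUpper hβ).mono fun s hs => show (0:ℝ) < s by linarith [hs.1]).log
      fun s hs => (QUpper_pos hκ hβ h0 hg (by linarith [hs.1])).ne'
  have hll : ContinuousOn (fun s : ℝ => Real.log (Real.log (2 * s))) (Icc 2 T) := by
    refine ContinuousOn.log ?_ fun s hs => (Real.log_pos (show (1:ℝ) < 2 * s by linarith [hs.1])).ne'
    refine Real.continuousOn_log.comp (continuousOn_const.mul continuousOn_id) fun s hs => ?_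
    simp only [Set.mem_compl_iff, Set.mem_singleton_iff]
    exact ne_of_gt (show (0:ℝ) < 2 * s by linarith [hs.1])
  have hcg : ContinuousOn (fun s => s * Real.log (Real.log (2 * s)) / Real.log s) (Icc 2 T) :=
    ContinuousOn.div (continuousOn_id.mul hll) (Real.continuousOn_log.mono fun s hs =>
      show s ≠ 0 from ne_of_gt (by linarith [hs.1])) fun s hs => (Real.log_pos (by linarith [hs.1])).ne'
  obtain ⟨K, hK, hKb⟩ := exists_ratio_le hcf hcg fun s hs => by
    have h1 := log_log_two_mul_pos hs.1
    have h2 := Real.log_pos (show (1:ℝ) < s by linarith [hs.1])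
    have h3 : (0:ℝ) < s := by linarith [hs.1]
    positivity
  set K₀ : ℝ := |Real.log M| + |Real.log m| + Real.log (1 + c₂) with hK₀def
  have hK₀0 : 0 ≤ K₀ := by
    have := Real.log_nonneg (show (1:ℝ) ≤ 1 + c₂ by linarith)
    positivity
  refine ⟨max K (K₀ + 2), fun s hs => ?_⟩
  rw [hmain s]
  have hs0 : 0 < s := by linarith
  have hg0 : 0 < s * Real.log (Real.log (2 * s)) / Real.log s := by
    have h1 := log_log_two_mul_pos hs
    have h2 := Real.log_pos (show (1:ℝ) < s by linarith)
    positivity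
  rcases le_or_gt s T with h | h
  · exact (hKb s ⟨hs, h⟩).trans (mul_le_mul_of_nonneg_right (le_max_left _ _) hg0.le)
  · -- large `s`: the two barriers
    have hQs := QUpper_pos hκ hβ h0 hg hs0
    have has : 0 < majA κ β s := majA_pos hκ hβ h0 hg hs0
    obtain ⟨-, -, hUa, haU⟩ := hQ s hs0
    have hU := hup s (by linarith)
    have hLw := hlow s (by linarith)
    -- upper: `log Q⁺ + Φ ≤ log M`
    have h1 : Real.log (QUpper κ β s) + Φ s ≤ Real.log M := by
      have := Real.log_le_log hQs (hUa.trans hU.le)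
      rw [Real.log_mul hM.ne' (Real.exp_pos _).ne', Real.log_exp] at this
      simp only [hΦdef]; linarith
    -- lower: `log Q⁺ + Φ ≥ log m - log (1 + c₂) - 2 s log log s / log s`
    have h2 : Real.log m - Real.log (1 + c₂) - 2 * (s * Real.log (Real.log s) / Real.log s) ≤
        Real.log (QUpper κ β s) + Φ s := by
      have hQge : m * Real.exp (-(s * Real.log s + s * Real.log (Real.log s) -
          s * Real.log (Real.exp 1 * κ) + 2 * (s * Real.log (Real.log s) / Real.log s))) / (1 + c₂) ≤
          QUpper κ β s := by
        rw [div_le_iff₀ (by linarith)]; linarith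
      have := Real.log_le_log (by positivity) hQge
      rw [Real.log_div (by positivity) (by linarith), Real.log_mul hm.ne' (Real.exp_pos _).ne',
        Real.log_exp] at this
      simp only [hΦdef]; linarith
    -- `|log Q⁺ + Φ| ≤ K₀ + 2 s log log s / log s ≤ (K₀ + 2) s log log (2s) / log s`
    have hls : 0 < Real.log s := Real.log_pos (by linarith)
    have hll1 : 1 ≤ Real.log (Real.log s) := by
      have hse : Real.exp (Real.exp 1) ≤ s := by linarith
      have h3 := Real.log_le_log (Real.exp_pos _) hse
      rw [Real.log_exp] at h3
      have h4 := Real.log_le_log (Real.exp_pos 1) h3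
      rwa [Real.log_exp] at h4
    have hll2 : Real.log (Real.log s) ≤ Real.log (Real.log (2 * s)) :=
      Real.log_le_log hls (Real.log_le_log hs0 (by linarith))
    have hsl : Real.log s ≤ s := (Real.log_le_sub_one_of_pos hs0).trans (by linarith)
    have hfrac : s * Real.log (Real.log s) / Real.log s ≤ s * Real.log (Real.log (2 * s)) / Real.log s :=
      div_le_div_of_nonneg_right (mul_le_mul_of_nonneg_left hll2 hs0.le) hls.le
    have hone : 1 ≤ s * Real.log (Real.log (2 * s)) / Real.log s := by
      rw [le_div_iff₀ hls]
      have : s * 1 ≤ s * Real.log (Real.log (2 * s)) := mul_le_mul_of_nonneg_left (by linarith) hs0.le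
      linarith
    have habs : |Real.log (QUpper κ β s) + Φ s| ≤ K₀ + 2 * (s * Real.log (Real.log s) / Real.log s) := by
      have hM' : Real.log M ≤ |Real.log M| := le_abs_self _
      have hm' : -|Real.log m| ≤ Real.log m := neg_abs_le _
      have hpos2 : 0 ≤ 2 * (s * Real.log (Real.log s) / Real.log s) :=
        mul_nonneg zero_le_two (div_nonneg (mul_nonneg hs0.le (by linarith)) hls.le)
      have hl12 : 0 ≤ Real.log (1 + c₂) := Real.log_nonneg (by linarith)
      have hK₀' : K₀ = |Real.log M| + |Real.log m| + Real.log (1 + c₂) := rfl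
      have haM : 0 ≤ |Real.log M| := abs_nonneg _
      have ham : 0 ≤ |Real.log m| := abs_nonneg _
      rw [abs_le]
      constructor
      · linarith
      · linarith
    calc |Real.log (QUpper κ β s) + Φ s| ≤ K₀ + 2 * (s * Real.log (Real.log s) / Real.log s) := habs
      _ ≤ K₀ * (s * Real.log (Real.log (2 * s)) / Real.log s) +
          2 * (s * Real.log (Real.log (2 * s)) / Real.log s) := by
          have := le_mul_of_one_le_right hK₀0 hone
          linarith
      _ = (K₀ + 2) * (s * Real.log (Real.log (2 * s)) / Real.log s) := by ring
      _ ≤ max K (K₀ + 2) * (s * Real.log (Real.log (2 * s)) / Real.log s) :=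
          mul_le_mul_of_nonneg_right (le_max_right _ _) hg0.le

/-- **Lemma 13 for the parameters `(κ, β)`**: (6.3)–(6.5) for all `s ≥ 2` with common constants
`c₁ > 0`, `c₂`, `C`. [cite: IwaniecActaArith1980, Lemma 13 (6.3)–(6.5)] -/
theorem lemma13_core :
    ∃ c₁ c₂ C : ℝ, 0 < c₁ ∧ ∀ s : ℝ, 2 ≤ s →
      c₁ * QUpper κ β s ≤ QLower κ β s ∧
      QLower κ β s ≤ c₂ * QUpper κ β s ∧
      c₁ * (QUpper κ β s * (s * Real.log s)) ≤ QUpper κ β (s - 1) ∧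
      QUpper κ β (s - 1) ≤ c₂ * (s ^ 2 * QUpper κ β s) ∧
      |Real.log (QUpper κ β s) -
          (-s * Real.log s - s * Real.log (Real.log s) + s * Real.log (Real.exp 1 * κ))| ≤
        C * (s * Real.log (Real.log (2 * s)) / Real.log s) := by
  obtain ⟨c₁, c₂, hc₁, hc₂, hQ⟩ := exists_QLower_le_QUpper hκ hβ h0 hg
  obtain ⟨cR, hcR, hR⟩ := exists_QUpper_sub_one_le hκ hβ h0 hg
  obtain ⟨cL, hcL, hL⟩ := exists_QUpper_sub_one_ge hκ hβ h0 hg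
  obtain ⟨C, hC⟩ := exists_abs_log_QUpper_le hκ hβ h0 hg
  refine ⟨min c₁ cL, max c₂ cR, C, lt_min hc₁ hcL, fun s hs => ?_⟩
  have hs0 : 0 < s := by linarith
  have hQs := QUpper_pos hκ hβ h0 hg hs0
  obtain ⟨h1, h2, -, -⟩ := hQ s hs0
  have hprod : 0 ≤ QUpper κ β s * (s * Real.log s) := by
    have := Real.log_nonneg (show (1:ℝ) ≤ s by linarith); positivity
  refine ⟨?_, ?_, ?_, ?_, hC s hs⟩
  · exact (mul_le_mul_of_nonneg_right (min_le_left _ _) hQs.le).trans h1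
  · exact h2.trans (mul_le_mul_of_nonneg_right (le_max_left _ _) hQs.le)
  · exact (mul_le_mul_of_nonneg_right (min_le_right _ _) hprod).trans (hL s hs)
  · exact (hR s hs).trans (mul_le_mul_of_nonneg_right (le_max_right _ _) (by positivity))

end Main

/-! ### The discharge -/

/-- **Iwaniec's Lemma 13 holds** (*Rosser's sieve*, Acta Arith. 36 (1980), §6, Lemma 13, p. 189, with
(6.1)–(6.5) and p. 173): for the greatest `β`-sieve data of dimension `κ > 1/2`, `β > 1`, `q^± > 0` on
`(0, ∞)`, and (6.3)–(6.5) hold for all `s ≥ 2` with constants depending on `κ`. Proof: `β > 1`,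
`g(β − 1) = 0` and `g > 0` beyond `β − 1` for the greatest data (`RosserSieveLemma14.lean`), then
`lemma13_core`. [cite: IwaniecActaArith1980, Lemma 13 with (6.1)–(6.5), and p. 173] -/
theorem Iwaniec1980_lemma13_holds : Iwaniec1980_lemma13 := by
  intro κ hκ B hB
  have hβ : 1 < B.2.2.1 := hB.one_lt_beta hκ
  have h0 : qFun κ (B.2.2.1 - 1) = 0 := hB.qFun_beta_sub_one hκ
  have hg : ∀ x : ℝ, B.2.2.1 - 1 < x → 0 < qFun κ x := fun x hx => hB.qFun_pos_of_gt hκ hx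
  have hκ0 : 0 < κ := by linarith
  exact ⟨hβ, fun s _ => qUpper_pos_qLower_pos hκ0 hβ h0 hg s, lemma13_core hκ0 hβ h0 hg⟩

end RosserMajorant

end Literature.NumberTheory.Sieve
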